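import Literature.AlgebraicGeometry.Resolution.RegularLocalRingsQuotient
import HarnessLib

/-!
# Crux `EquisingularLift` (stmt-ResolutionOfSingularities-15660), line `Sketch` (= `strata-split` v6):
# move-set stub `stub_regularLift_of_not_dvd`

[OURS · L1 W4.5b] Registered stub of the skeleton `Cruxes/EquisingularLift/Lines/Sketch.lean`
(sha `ec60f88acc0b`), proved BY NAME AND SIGNATURE. NOT a statement of any manuscript.

**Statement** (lifting half of the trace dictionary, one equation). In a regular local ring `R` with
`ϖ ∈ 𝔪 ∖ 𝔪²` and `g ∈ 𝔪` not divisible by `ϖ`, some re-lift `g + ϖh` of `g mod ϖ` cuts out a regular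
hypersurface `R/(g + ϖh)` of dimension `dim R - 1` on which `ϖ` is non-zero.

**Proof.** Take `h = 0` if `g ∉ 𝔪²` and `h = 1` otherwise; in both cases `g + ϖh ∈ 𝔪 ∖ 𝔪²`, so
`R/(g + ϖh)` is regular of dimension `dim R - 1` by Matsumura Thm. 14.2
(`IsRegularLocalRing.quotient_span_singleton`). If `ϖ = (g + ϖh)·a`, then either `a` is a unit, and
`g = ϖ(a⁻¹ - h)` contradicts `ϖ ∤ g`, or `a ∈ 𝔪`, and `ϖ ∈ 𝔪·𝔪 = 𝔪²`, a contradiction.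
-/

set_option linter.dupNamespace false -- mandated namespace `Summit.<Summit>.<Problem>` of this single-conjunct summit

namespace Summit.ResolutionOfSingularities.ResolutionOfSingularities.Cruxes.EquisingularLift.StrataSplit

open IsLocalRing Literature.AlgebraicGeometry.Resolution

/-- In a local ring, if `ϖ ∉ 𝔪²`, `t ∈ 𝔪` and `ϖ ∈ (t)`, then `t = ϖ·v` for some `v`
(the cofactor is a unit). [OURS · L1 W4.5b] helper for `stub_regularLift_of_not_dvd`. -/
theorem exists_eq_mul_of_mem_span_singleton_of_not_mem_sq {R : Type*} [CommRing R] [IsLocalRing R]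
    {ϖ t : R} (hϖ2 : ϖ ∉ maximalIdeal R ^ 2) (ht : t ∈ maximalIdeal R)
    (hmem : ϖ ∈ Ideal.span {t}) : ∃ v : R, t = ϖ * v := by
  rw [Ideal.mem_span_singleton] at hmem
  obtain ⟨a, ha⟩ := hmem
  by_cases hau : IsUnit a
  · obtain ⟨u, rfl⟩ := hau
    refine ⟨↑u⁻¹, ?_⟩
    rw [ha, mul_assoc, Units.mul_inv, mul_one]
  · exfalso
    apply hϖ2
    rw [ha, pow_two]
    exact Ideal.mul_mem_mul ht ((mem_maximalIdeal a).mpr hau)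

/-- **Stub `stub_regularLift_of_not_dvd`** of line `Sketch` for the crux `EquisingularLift`
(stmt-ResolutionOfSingularities-15660), by name and signature: in a regular local ring `R` with
`ϖ ∈ 𝔪 ∖ 𝔪²` and `g ∈ 𝔪` not divisible by `ϖ`, there is `h` with `R/(g + ϖh)` regular local,
`dim R/(g + ϖh) + 1 = dim R` and `ϖ ∉ (g + ϖh)` (take `h = 0` if `g ∉ 𝔪²`, else `h = 1`).
[OURS · L1 W4.5b] move-set lemma; NOT a statement of the manuscript. -/
theorem stub_regularLift_of_not_dvd : ∀ (R : Type) [CommRing R] [IsRegularLocalRing R] (ϖ g : R), ϖ ∈ IsLocalRing.maximalIdeal R → ϖ ∉ IsLocalRing.maximalIdeal R ^ 2 → g ∈ IsLocalRing.maximalIdeal R → ¬ (ϖ ∣ g) → ∃ h : R, IsRegularLocalRing (R ⧸ Ideal.span {g + ϖ * h}) ∧ ringKrullDim (R ⧸ Ideal.span {g + ϖ * h}) + 1 = ringKrullDim R ∧ ϖ ∉ Ideal.span {g + ϖ * h} := by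
  intro R _ _ ϖ g hϖ hϖ2 hg hndvd
  by_cases hg2 : g ∈ maximalIdeal R ^ 2
  · -- `g ∈ 𝔪²`: re-lift by `h = 1`
    refine ⟨1, ?_⟩
    have hmem : g + ϖ * 1 ∈ maximalIdeal R := add_mem hg (Ideal.mul_mem_right _ _ hϖ)
    have hnot : g + ϖ * 1 ∉ maximalIdeal R ^ 2 := by
      intro h
      apply hϖ2
      have := sub_mem h hg2
      simpa using this
    obtain ⟨hreg, hdim⟩ := IsRegularLocalRing.quotient_span_singleton hmem hnot
    refine ⟨hreg, hdim, fun hϖmem => hndvd ?_⟩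
    obtain ⟨v, hv⟩ := exists_eq_mul_of_mem_span_singleton_of_not_mem_sq hϖ2 hmem hϖmem
    exact ⟨v - 1, by linear_combination hv⟩
  · -- `g ∉ 𝔪²`: keep `g` (`h = 0`)
    refine ⟨0, ?_⟩
    have hmem : g + ϖ * 0 ∈ maximalIdeal R := by simpa using hg
    have hnot : g + ϖ * 0 ∉ maximalIdeal R ^ 2 := by simpa using hg2
    obtain ⟨hreg, hdim⟩ := IsRegularLocalRing.quotient_span_singleton hmem hnot
    refine ⟨hreg, hdim, fun hϖmem => hndvd ?_⟩
    obtain ⟨v, hv⟩ := exists_eq_mul_of_mem_span_singleton_of_not_mem_sq hϖ2 hmem hϖmem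
    exact ⟨v, by linear_combination hv⟩

end Summit.ResolutionOfSingularities.ResolutionOfSingularities.Cruxes.EquisingularLift.StrataSplit
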